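import Mathlib
import HarnessLib
import Summits.NavierStokesRegularity.NavierStokesRegularity.Theses.LocalLevelHeadDoor
import Summits.NavierStokesRegularity.NavierStokesRegularity.Theorems.LocalPressureProfileDoorLocalPointZoomSimilarityPressure

/-!
# `LocalLevelHeadDoor.LocalPointZoomSimilarityHead` (item stmt-NavierStokesRegularity-28097) — the JOINT similarity zoom
# (velocities' kinetic energy AND similarity pressures), PROVED

At a point which is locally space–time Type I but not backward bounded, the parabolic point zoom along scales `λ_j → 0` yields
`C, D`, a door-class profile `v` with backward-singular apex and, at every `(t, y)`, `t < 0`, with `t_j = T + λ_j² t/ν`, convergence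
of the rescaled similarity pressures `ν⁻¹(T−t_j) Q[u(t_j)](x₀ + √(T−t_j)√ν y) → (−t) Q[v(t)](√(−t) y)` (VERBATIM the conclusion of the
PROVED item 20181) AND of the rescaled kinetic energies `ν⁻¹(T−t_j)|u(t_j)(x₀ + √(T−t_j)√ν y)|² → (−t)|v(t)(√(−t) y)|²`.  Both limits
come from ONE frame, `localPointZoomPressureSlices` (velocities and pressures on every slice), read at `z = √(−t) y`: the pressure
clause is the 20181 computation verbatim (affine covariance `pressurePotential_smul_comp_affine`, `√(T−t_j)√ν = λ_j√(−t)`,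
`ν⁻¹(T−t_j) = (−t)(λ_j/ν)²`), the energy clause is the same bookkeeping followed by continuity of `‖·‖²`.

HONEST FRAMING: a compactness/bookkeeping lemma about a HYPOTHETICAL locally Type-I blow-up (support item of a DRAFT door route);
nothing here bears on the door's cruxes 28095/28096, on its `Target`, or on Navier–Stokes regularity.
-/

noncomputable section

set_option linter.dupNamespace false

namespace Summit.NavierStokesRegularity.NavierStokesRegularity.Theorems

open MeasureTheory Set Function Filter Topology Metric
open Literature.Analysis Literature.Analysis.FluidPDE
open Summit.NavierStokesRegularity.NavierStokesRegularity.Theorems.LocalPressureProfileDoorLocalPointZoomSimilarityPressure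
open Summit.NavierStokesRegularity.NavierStokesRegularity.Theorems.LocalPressureProfileDoorPressureCovariance

/-- **Item stmt-NavierStokesRegularity-28097** (`LocalLevelHeadDoor.LocalPointZoomSimilarityHead`): the joint similarity zoom of the
kinetic energies and the similarity pressures at a locally space–time Type-I, not backward bounded point.
[cite: SereginSverak2009, §3; KochNadirashviliSereginSverak2009, §5–6; Tsai1998, §2] -/
theorem localLevelHeadDoor_localPointZoomSimilarityHead_proof :
    Summit.NavierStokesRegularity.NavierStokesRegularity.Theses.LocalLevelHeadDoor.LocalPointZoomSimilarityHead := by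
  intro ν T hν hT u p hsol hLH hdec x₀ ρ M hρ hMst hnotbd
  obtain ⟨C, D, v, lam, hlam, hlam0, hrate, hdecay, hcont, hmild, hdiv, hsing, hconv⟩ :=
    localPointZoomPressureSlices ν T hν hT u p hsol hLH hdec x₀ ρ M hρ hMst hnotbd
  refine ⟨C, D, v, lam, hlam, hlam0, hrate, hdecay, hcont, hmild, hdiv, hsing, fun t ht y => ?_⟩
  have hnt : 0 < -t := neg_pos.2 ht
  obtain ⟨hVz, hP⟩ := hconv t ht (Real.sqrt (-t) • y)
  -- the zoom times lie in `[0, T)` eventually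
  have htjT : Tendsto (fun j => T + lam j ^ 2 * t / ν) atTop (𝓝 T) := by
    have h : Tendsto (fun j => T + lam j ^ 2 * t / ν) atTop (𝓝 (T + 0 ^ 2 * t / ν)) :=
      tendsto_const_nhds.add (((hlam0.pow 2).mul_const t).div_const ν)
    have e : T + (0 : ℝ) ^ 2 * t / ν = T := by ring
    rw [e] at h
    exact h
  have htj_lt : ∀ j, T + lam j ^ 2 * t / ν < T := fun j => by
    have : lam j ^ 2 * t / ν < 0 := div_neg_of_neg_of_pos (mul_neg_of_pos_of_neg (pow_pos (hlam j) 2) ht) hν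
    linarith
  have hev_t : ∀ᶠ j in atTop, T + lam j ^ 2 * t / ν ∈ Ico 0 T :=
    (htjT.eventually (lt_mem_nhds hT)).mono fun j hj => ⟨hj.le, htj_lt j⟩
  -- bookkeeping: `T − tⱼ = λⱼ²(−t)/ν`, `√(T − tⱼ)√ν = λⱼ√(−t)`
  have hdt : ∀ j, T - (T + lam j ^ 2 * t / ν) = lam j ^ 2 * (-t) / ν := fun j => by ring
  have hdt0 : ∀ j, 0 ≤ lam j ^ 2 * (-t) / ν := fun j => div_nonneg (mul_nonneg (sq_nonneg _) hnt.le) hν.le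
  have hsq : ∀ j, Real.sqrt (lam j ^ 2 * (-t) / ν) * Real.sqrt ν = lam j * Real.sqrt (-t) := fun j => by
    rw [← Real.sqrt_mul (hdt0 j) ν, show lam j ^ 2 * (-t) / ν * ν = (lam j * Real.sqrt (-t)) ^ 2 by
      rw [mul_pow, Real.sq_sqrt hnt.le]; field_simp]
    exact Real.sqrt_sq (mul_nonneg (hlam j).le (Real.sqrt_nonneg _))
  refine ⟨?_, ?_⟩
  · -- the similarity pressures (item 20181's computation, verbatim)
    refine ((hP.const_mul (-t)).congr' ?_)
    filter_upwards [hev_t] with j hj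
    have hl := hlam j
    have hC2 : ContDiff ℝ 2 (u (T + lam j ^ 2 * t / ν)) := (hsol.contDiff_velocity hj).of_le (by norm_cast)
    have hL2 : Integrable fun x => ‖u (T + lam j ^ 2 * t / ν) x‖ ^ 2 :=
      (hLH.memLp _ ⟨hj.1, hj.2.le⟩).integrable_norm_pow two_ne_zero
    rw [pressurePotential_smul_comp_affine hC2 hL2 (lam j / ν) hl x₀ (Real.sqrt (-t) • y)]
    rw [hdt j]
    simp only [smul_smul]
    rw [hsq j]
    ring
  · -- the kinetic energies: `ν⁻¹(T − tⱼ)|u|² = (−t)|(λⱼ/ν) • u|²`, continuity of `‖·‖²`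
    refine (((hVz.norm).pow 2).const_mul (-t)).congr fun j => ?_
    rw [norm_smul, mul_pow, Real.norm_eq_abs, abs_of_pos (div_pos (hlam j) hν), hdt j,
      smul_smul (Real.sqrt (lam j ^ 2 * (-t) / ν)) (Real.sqrt ν) y, hsq j, smul_smul (lam j) (Real.sqrt (-t)) y]
    field_simp

end Summit.NavierStokesRegularity.NavierStokesRegularity.Theorems

end
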